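import Summits.BirchSwinnertonDyer.BirchSwinnertonDyer.Theorems.ErratumRoadFiveRest3BranchesDefs
import HarnessLib

/-!
# Route `ErratumRoadFive` (rung K2, `p ≥ 5`), crux `RamNoErratumDataAtFive` (item stmt-BirchSwinnertonDyer-19624, REST‴):
# the `Ш_an` CERTIFICATE — the crux's conclusion at a pair from the single datum `ord_p #Ш(E)_an ≤ 0`
# (cell `bsd-stepL`, owner seat `bsd-stepL-rest-p2` g4; `--supports stmt-BirchSwinnertonDyer-19624`; THEOREMS ONLY — no
# definition, no named fact, no `sorry`; Theses-FREE, so a route file may cite it)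

HONEST FRAMING. Bookkeeping over imc-p1's ONE-SIDED TIGHTNESS `openInputOnTreeAt_of_missingLowerBoundAt_of_ram_of_thm331Mult`
(`ErratumRoadFiveControlFromJSWMult.lean`, p432484): on the (ram) part of class X11b the route-p2 open input
`P2OpenInputOnTreeAt W p` follows from the LOWER HALF `Typed.MissingLowerBoundAt W p` (`ord_p #Ш(E)_an ≤ ord_p #Ш(E)`) plus
published facts (Gross–Zagier, Kolyvagin, Skinner 2016 Thm. C, GZK, modularity) and the Jetchev–Skinner–Wan control identity
(Thm. 3.3.1-mult, by citation). The lower half is implied by the datum `#Ш(E)_an = s ∈ ℚ` with `ord_p s ≤ 0` (since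
`0 ≤ ord_p #Ш(E)`), a per-pair DATA binder in the programme's record currency (`{s : ℚ} (hs : shaAn W = s) (hv : padicValRat p s ≤ 0)`,
cf. `Theorems.X6.bsdp_spr_*`: Cremona `allbsd`). So the per-pair certificate of REST‴ needs NO Heegner field, NO Heegner point,
NO index, NO regulator identity and NO preprint: the owner's g3 GZ-sharp certificate (`gzSharpIndexAt_iff_shaAn_nonpos`, p506557) is
this datum read at one field. Every published named fact is a HYPOTHESIS; the datum is attested per pair, never asserted; BSD
is proved for no pair; nothing is booked; no census word moves (T7). CLASS-WIDE the datum is FALSE exactly at the pairs with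
`Ш(E)[p] ≠ 0` (granted `BSD(E,p)`: §1 `shaAn_nonpos_iff_not_dvd_shaOrder_of_bsdp`) — there the crux keeps needing a
main-conjecture input; the census of record (HOME/rest/SHA-CENSUS-REST3.md, this seat) finds NO such pair among the 703 204
REST‴ pairs with `N < 5·10⁵` (Cremona's `#Ш_an ∈ {1, 4, 9, 16, 25}`, never divisible by the pair's `p ≥ 5`).

* §1 `missingLowerBoundAt_of_shaAn_nonpos` (datum ⟹ lower half), `shaAn_nonpos_of_missingLowerBoundAt_of_not_dvd`,
  `shaAn_nonpos_iff_not_dvd_shaOrder_of_bsdp` (BSD reading of the datum: `p ∤ #Ш(E)`).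
* §2 `openInputOnTreeAt_of_shaAn_nonpos_of_thm331Mult` — per pair: the open input from the datum (the record SHAPE).
* §3 class level, Theses-free: the registered stubs `stub_rest3_locus` / `stub_rest3_tam` VERBATIM, the branch constants
  `Rest3TorsionBranchAtFive` / `Rest3NoWitnessBranchAtFive`, and the crux body VERBATIM, each ⟸ published facts + JSW17
  3.3.1-mult + the datum on its pairs. The by-name forms over the route's support items live in the companion
  `ErratumRoadFiveRest3ShaAnCertificateByName.lean`.

References: [Miller2011LMS] §1, Def. 1.1; [JetchevSkinnerWan2017] Thm. 3.3.1, §3.5 (3.5.c), §7.4.1; [Castella2018] Thms. 2.3,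
3.2; [Skinner2016PacificMC] Thm. C; [GrossZagier1986] V.§2; [Gross1991] (1.1); [Castella2018Erratum] Thm. 1.1 (iii)–(iv);
[Cremona1997] Table 4 (`#Ш_an`).
-/

-- the Theorems namespace of this sub repeats the summit name by design (D-0017 nested layout)
set_option linter.dupNamespace false
set_option autoImplicit false

noncomputable section

open scoped Classical

namespace Summit.BirchSwinnertonDyer.BirchSwinnertonDyer.Theorems

open WeierstrassCurve NumberField Literature.NumberTheory.EllipticCurves
  Literature.NumberTheory.EllipticCurves.Rank1Residual
  Literature.NumberTheory.EllipticCurves.Rank1Residual.Typed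
  Summit.BirchSwinnertonDyer.Rank1Residual Summit.BirchSwinnertonDyer.Rank1Residual.X11b

/-! ## §1 The datum `ord_p #Ш(E)_an ≤ 0` and the lower half of `BSD(E,p)` -/

/-- **The `Ш_an` datum gives the lower half.** If `#Ш(E)_an = s ∈ ℚ` with `ord_p s ≤ 0` then
`Typed.MissingLowerBoundAt W p` (`ord_p #Ш(E)_an ≤ ord_p #Ш(E)`), because `0 ≤ ord_p #Ш(E)` (for infinite `Ш` the tree's
`shaOrder` is the junk value `0`, valuation `0`). Pure bookkeeping; the datum is a per-pair DATA binder, never asserted.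
[cite: Miller2011LMS, §1 and Def. 1.1 (arXiv:1010.2431 p. 3)] -/
theorem missingLowerBoundAt_of_shaAn_nonpos (W : WeierstrassCurve ℚ) (p : ℕ) {s : ℚ}
    (hs : shaAn W = (s : ℂ)) (hv : padicValRat p s ≤ 0) : Typed.MissingLowerBoundAt W p :=
  ⟨s, hs, hv.trans (by exact_mod_cast Nat.zero_le _)⟩

/-- **Conversely, granted `p ∤ #Ш(E)`** (e.g. `Ш(E)[p] = 0` with `Ш(E)` finite): the lower half IS the datum. Bookkeeping.
[cite: Miller2011LMS, §1 and Def. 1.1] -/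
theorem shaAn_nonpos_of_missingLowerBoundAt_of_not_dvd (W : WeierstrassCurve ℚ) (p : ℕ)
    (h : Typed.MissingLowerBoundAt W p) (hndvd : ¬ p ∣ W.shaOrder) :
    ∃ s : ℚ, shaAn W = (s : ℂ) ∧ padicValRat p s ≤ 0 := by
  obtain ⟨s, hs, hle⟩ := h
  refine ⟨s, hs, ?_⟩
  have h0 : padicValNat p W.shaOrder = 0 := padicValNat.eq_zero_of_not_dvd hndvd
  rw [h0] at hle
  exact_mod_cast hle

/-- **BSD reading of the datum (honesty).** Granted GZK (`rank = r_an`, `Ш(E)` finite in analytic rank `≤ 1`) and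
`BSD(E,p)` itself, the datum `ord_p #Ш(E)_an ≤ 0` holds iff `p ∤ #Ш(E)`. So, granted BSD, the class-level hypothesis of §3
FAILS exactly at the pairs with `Ш(E)[p] ≠ 0`: the `Ш_an` certificate is a per-pair currency, not a road. Bookkeeping.
[cite: Miller2011LMS, Def. 1.1 (arXiv:1010.2431 p. 3)] [cite: Darmon2004, Thm. 3.22] -/
theorem shaAn_nonpos_iff_not_dvd_shaOrder_of_bsdp (W : WeierstrassCurve ℚ) [W.IsElliptic] (p : ℕ) [Fact p.Prime]
    (hGZK : rank_eq_analyticRank_of_analyticRank_le_one) (hr : W.analyticRank ≤ 1) (hB : BSDp W p) :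
    (∃ s : ℚ, shaAn W = (s : ℂ) ∧ padicValRat p s ≤ 0) ↔ ¬ p ∣ W.shaOrder := by
  have hp : p.Prime := Fact.out
  haveI hfin : Finite W.sha := (hGZK W hr).2
  have hpos : 0 < W.shaOrder := W.shaOrder_pos hfin
  obtain ⟨q, hq, hv⟩ := missingPPartAt_of_bsdp W p hB
  constructor
  · rintro ⟨s, hs, hle⟩ hdvd
    have hqq : s = q := by exact_mod_cast hs.symm.trans hq
    rw [hqq, hv] at hle
    have h1 : 1 ≤ padicValNat p W.shaOrder :=
      (padicValNat_dvd_iff_le hpos.ne').mp (by simpa using hdvd)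
    omega
  · intro hndvd
    refine ⟨q, hq, ?_⟩
    rw [hv, padicValNat.eq_zero_of_not_dvd hndvd]
    simp

/-! ## §2 Per pair: the open input from the datum (the record shape) -/

/-- **THE `Ш_an` CERTIFICATE (per pair, record shape).** For a globally minimal elliptic `W/ℚ` and a prime `p` with a (ram)
witness (`Ram W p`): the published facts Gross–Zagier `hGZ`, Kolyvagin `hKo`, Skinner 2016 Thm. C `hSk`, GZK `hGZK`, modularity
`hmod`, the Jetchev–Skinner–Wan control identity `h331` (Thm. 3.3.1-mult, by citation), and ONE datum `#Ш(E)_an = s ∈ ℚ` with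
`ord_p s ≤ 0` ⟹ route p2's open input `P2OpenInputOnTreeAt W p` (vacuous off `ClassX11b ∧ 5 ≤ p ∧ Surj`). Proof: §1 + imc-p1's
one-sided tightness `openInputOnTreeAt_of_missingLowerBoundAt_of_ram_of_thm331Mult`. NO Heegner field, point, index or
regulator enters the hypotheses. CONDITIONAL on every binder; the datum is attested per pair (Cremona `allbsd` / PARI), never
asserted; nothing booked. [cite: JetchevSkinnerWan2017, Thm. 3.3.1 with §3.5 (3.5.c), §7.4.1 (pp. 30–31)]
[cite: Castella2018, Thm. 2.3 (p. 5), Thm. 3.2 (p. 9)] [cite: Skinner2016PacificMC, Thm. C (§1) and footnote 1]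
[cite: Miller2011LMS, Def. 1.1] -/
theorem openInputOnTreeAt_of_shaAn_nonpos_of_thm331Mult
    (W : WeierstrassCurve ℚ) [W.IsElliptic] [W.IsGloballyMinimal] (p : ℕ) [Fact p.Prime]
    (h331 : JetchevSkinnerWan2017.thm331_anticyclotomicControl_mult)
    (hGZ : ∀ (N : ℕ) [NeZero N] (W : WeierstrassCurve ℚ) (K : Type) [Field K] [NumberField K],
      gross_zagier N W K)
    (hKo : ∀ (N : ℕ) [NeZero N] (W : WeierstrassCurve ℚ) (K : Type) [Field K] [NumberField K],
      kolyvagin N W K)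
    (hSk : Skinner2016.thmC_padicValRat_bsd_rank_zero)
    (hGZK : rank_eq_analyticRank_of_analyticRank_le_one) (hmod : hasEntireLFunction_rat)
    (hram : Ram W p) {s : ℚ} (hs : shaAn W = (s : ℂ)) (hv : padicValRat p s ≤ 0) :
    P2OpenInputOnTreeAt W p :=
  openInputOnTreeAt_of_missingLowerBoundAt_of_ram_of_thm331Mult W p h331 hGZ hKo hSk hGZK hmod hram
    (missingLowerBoundAt_of_shaAn_nonpos W p hs hv)

/-! ## §3 Class level (Theses-free): stubs VERBATIM, branches, and the crux body from the datum on their pairs -/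

/-- **Registered stub `stub_rest3_locus` (crux 19624, skeleton v2 d79431634e7b) VERBATIM ⟸ the `Ш_an` datum on the Locus
REST‴ pairs**: published facts + JSW17 Thm. 3.3.1-mult + `hSha` (at every X11b pair with `p ≥ 5`, `ρ̄` onto, a (ram) witness,
no erratum datum and `p ∤ ∏ c_ℓ`: `#Ш(E)_an = s`, `ord_p s ≤ 0`). CONDITIONAL; `hSha` is a per-pair data currency (granted BSD
it fails exactly where `Ш(E)[p] ≠ 0`); nothing booked. [cite: JetchevSkinnerWan2017, Thm. 3.3.1, §7.4.1]
[cite: Skinner2016PacificMC, Thm. C (§1)] [cite: SkinnerZhang2014, Thm. 1.3 (the Locus road NOT taken here)] -/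
theorem rest3Locus_of_shaAnNonpos_of_thm331Mult
    (h331 : JetchevSkinnerWan2017.thm331_anticyclotomicControl_mult)
    (hGZ : ∀ (N : ℕ) [NeZero N] (W : WeierstrassCurve ℚ) (K : Type) [Field K] [NumberField K],
      gross_zagier N W K)
    (hKo : ∀ (N : ℕ) [NeZero N] (W : WeierstrassCurve ℚ) (K : Type) [Field K] [NumberField K],
      kolyvagin N W K)
    (hSk : Skinner2016.thmC_padicValRat_bsd_rank_zero)
    (hGZK : rank_eq_analyticRank_of_analyticRank_le_one) (hmod : hasEntireLFunction_rat)
    (hSha : ∀ (W : WeierstrassCurve ℚ) [W.IsElliptic] [W.IsGloballyMinimal] (p : ℕ) [Fact p.Prime],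
      ClassX11b W p → 5 ≤ p → Rank1Residual.Surj W p → Rank1Residual.Ram W p →
      ¬ ((∃ (q : ℕ) (_ : Fact q.Prime), q ≠ 2 ∧ q ≠ p ∧ Rank1Residual.Mult W q ∧
          ¬ W.HasSplitMultiplicativeReductionAtPrime q ∧ ¬ p ∣ padicValInt q W.minimalDiscriminantInt) ∧
        (∀ P : (W.baseChange ℚ_[p]).toAffine.Point, p • P = 0 → P = 0)) →
      ¬ p ∣ W.tamagawaProduct → ∃ s : ℚ, shaAn W = (s : ℂ) ∧ padicValRat p s ≤ 0) :
    ∀ (W : WeierstrassCurve ℚ) [W.IsElliptic] [W.IsGloballyMinimal] (p : ℕ) [Fact p.Prime],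
      Literature.NumberTheory.EllipticCurves.Rank1Residual.Ram W p →
      ¬ ((∃ (q : ℕ) (_ : Fact q.Prime), q ≠ 2 ∧ q ≠ p ∧ Literature.NumberTheory.EllipticCurves.Rank1Residual.Mult W q ∧
          ¬ W.HasSplitMultiplicativeReductionAtPrime q ∧ ¬ p ∣ padicValInt q W.minimalDiscriminantInt) ∧
        (∀ P : (W.baseChange ℚ_[p]).toAffine.Point, p • P = 0 → P = 0)) →
      ¬ p ∣ W.tamagawaProduct →
      Summit.BirchSwinnertonDyer.Rank1Residual.X11b.P2OpenInputOnTreeAt W p := by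
  intro W _ _ p _ hram hno htam
  refine p2OpenInputOnTreeAt_of_imp_surj W p fun hX hp5 hsj ↦ ?_
  obtain ⟨s, hs, hv⟩ := hSha W p hX hp5 hsj hram hno htam
  exact openInputOnTreeAt_of_shaAn_nonpos_of_thm331Mult W p h331 hGZ hKo hSk hGZK hmod hram hs hv

/-- **Registered stub `stub_rest3_tam` (REST⁗) VERBATIM ⟸ the `Ш_an` datum on the REST⁗ pairs** (`p ∣ ∏ c_ℓ`): published
facts + JSW17 Thm. 3.3.1-mult + `hSha`. CONDITIONAL; data currency; nothing booked. Supersedes, hypothesis-wise, the owner's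
slack (p473288) and GZ-sharp (p508874) forms: no Heegner datum is asked. [cite: JetchevSkinnerWan2017, Thm. 3.3.1, §7.4.1]
[cite: Skinner2016PacificMC, Thm. C (§1)] [cite: Castella2018Erratum, Thm. 1.1 (iii)–(iv)] -/
theorem rest3Tam_of_shaAnNonpos_of_thm331Mult
    (h331 : JetchevSkinnerWan2017.thm331_anticyclotomicControl_mult)
    (hGZ : ∀ (N : ℕ) [NeZero N] (W : WeierstrassCurve ℚ) (K : Type) [Field K] [NumberField K],
      gross_zagier N W K)
    (hKo : ∀ (N : ℕ) [NeZero N] (W : WeierstrassCurve ℚ) (K : Type) [Field K] [NumberField K],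
      kolyvagin N W K)
    (hSk : Skinner2016.thmC_padicValRat_bsd_rank_zero)
    (hGZK : rank_eq_analyticRank_of_analyticRank_le_one) (hmod : hasEntireLFunction_rat)
    (hSha : ∀ (W : WeierstrassCurve ℚ) [W.IsElliptic] [W.IsGloballyMinimal] (p : ℕ) [Fact p.Prime],
      ClassX11b W p → 5 ≤ p → Rank1Residual.Surj W p → Rank1Residual.Ram W p →
      ¬ ((∃ (q : ℕ) (_ : Fact q.Prime), q ≠ 2 ∧ q ≠ p ∧ Rank1Residual.Mult W q ∧
          ¬ W.HasSplitMultiplicativeReductionAtPrime q ∧ ¬ p ∣ padicValInt q W.minimalDiscriminantInt) ∧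
        (∀ P : (W.baseChange ℚ_[p]).toAffine.Point, p • P = 0 → P = 0)) →
      p ∣ W.tamagawaProduct → ∃ s : ℚ, shaAn W = (s : ℂ) ∧ padicValRat p s ≤ 0) :
    ∀ (W : WeierstrassCurve ℚ) [W.IsElliptic] [W.IsGloballyMinimal] (p : ℕ) [Fact p.Prime],
      Literature.NumberTheory.EllipticCurves.Rank1Residual.Ram W p →
      ¬ ((∃ (q : ℕ) (_ : Fact q.Prime), q ≠ 2 ∧ q ≠ p ∧ Literature.NumberTheory.EllipticCurves.Rank1Residual.Mult W q ∧
          ¬ W.HasSplitMultiplicativeReductionAtPrime q ∧ ¬ p ∣ padicValInt q W.minimalDiscriminantInt) ∧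
        (∀ P : (W.baseChange ℚ_[p]).toAffine.Point, p • P = 0 → P = 0)) →
      p ∣ W.tamagawaProduct →
      Summit.BirchSwinnertonDyer.Rank1Residual.X11b.P2OpenInputOnTreeAt W p := by
  intro W _ _ p _ hram hno htam
  refine p2OpenInputOnTreeAt_of_imp_surj W p fun hX hp5 hsj ↦ ?_
  obtain ⟨s, hs, hv⟩ := hSha W p hX hp5 hsj hram hno htam
  exact openInputOnTreeAt_of_shaAn_nonpos_of_thm331Mult W p h331 hGZ hKo hSk hGZK hmod hram hs hv

/-- **Branch (T) `Rest3TorsionBranchAtFive` (item 19702, BY NAME) ⟸ the `Ш_an` datum on the (T) pairs** (`E(ℚ_p)[p] ≠ 0`):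
published facts + JSW17 Thm. 3.3.1-mult + `hSha` asked at every X11b pair with `p ≥ 5`, `ρ̄` onto, a (ram) witness and a
non-zero `p`-torsion point of `E(ℚ_p)`. CONDITIONAL; data currency; nothing booked.
[cite: JetchevSkinnerWan2017, Thm. 3.3.1, §7.4.1] [cite: Castella2018Erratum, Thm. 1.1 (iv)] -/
theorem rest3TorsionBranchAtFive_of_shaAnNonpos_of_thm331Mult
    (h331 : JetchevSkinnerWan2017.thm331_anticyclotomicControl_mult)
    (hGZ : ∀ (N : ℕ) [NeZero N] (W : WeierstrassCurve ℚ) (K : Type) [Field K] [NumberField K],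
      gross_zagier N W K)
    (hKo : ∀ (N : ℕ) [NeZero N] (W : WeierstrassCurve ℚ) (K : Type) [Field K] [NumberField K],
      kolyvagin N W K)
    (hSk : Skinner2016.thmC_padicValRat_bsd_rank_zero)
    (hGZK : rank_eq_analyticRank_of_analyticRank_le_one) (hmod : hasEntireLFunction_rat)
    (hSha : ∀ (W : WeierstrassCurve ℚ) [W.IsElliptic] [W.IsGloballyMinimal] (p : ℕ) [Fact p.Prime],
      ClassX11b W p → 5 ≤ p → Rank1Residual.Surj W p → Rank1Residual.Ram W p →
      (∃ P : (W.baseChange ℚ_[p]).toAffine.Point, p • P = 0 ∧ P ≠ 0) →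
      ∃ s : ℚ, shaAn W = (s : ℂ) ∧ padicValRat p s ≤ 0) :
    Rest3TorsionBranchAtFive := by
  intro W _ _ p _ hram hP
  refine p2OpenInputOnTreeAt_of_imp_surj W p fun hX hp5 hsj ↦ ?_
  obtain ⟨s, hs, hv⟩ := hSha W p hX hp5 hsj hram hP
  exact openInputOnTreeAt_of_shaAn_nonpos_of_thm331Mult W p h331 hGZ hKo hSk hGZK hmod hram hs hv

/-- **Branch (NW) `Rest3NoWitnessBranchAtFive` (item 19703, BY NAME) ⟸ the `Ш_an` datum on the (NW) pairs** (`E(ℚ_p)[p] = 0`,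
no odd non-split `E[p]`-ramified multiplicative `q ≠ p`): published facts + JSW17 Thm. 3.3.1-mult + `hSha`. CONDITIONAL;
data currency; nothing booked. [cite: JetchevSkinnerWan2017, Thm. 3.3.1, §7.4.1] [cite: Castella2018Erratum, Thm. 1.1 (iii)] -/
theorem rest3NoWitnessBranchAtFive_of_shaAnNonpos_of_thm331Mult
    (h331 : JetchevSkinnerWan2017.thm331_anticyclotomicControl_mult)
    (hGZ : ∀ (N : ℕ) [NeZero N] (W : WeierstrassCurve ℚ) (K : Type) [Field K] [NumberField K],
      gross_zagier N W K)
    (hKo : ∀ (N : ℕ) [NeZero N] (W : WeierstrassCurve ℚ) (K : Type) [Field K] [NumberField K],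
      kolyvagin N W K)
    (hSk : Skinner2016.thmC_padicValRat_bsd_rank_zero)
    (hGZK : rank_eq_analyticRank_of_analyticRank_le_one) (hmod : hasEntireLFunction_rat)
    (hSha : ∀ (W : WeierstrassCurve ℚ) [W.IsElliptic] [W.IsGloballyMinimal] (p : ℕ) [Fact p.Prime],
      ClassX11b W p → 5 ≤ p → Rank1Residual.Surj W p → Rank1Residual.Ram W p →
      (∀ P : (W.baseChange ℚ_[p]).toAffine.Point, p • P = 0 → P = 0) →
      ¬ (∃ (q : ℕ) (_ : Fact q.Prime), q ≠ 2 ∧ q ≠ p ∧ Rank1Residual.Mult W q ∧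
          ¬ W.HasSplitMultiplicativeReductionAtPrime q ∧ ¬ p ∣ padicValInt q W.minimalDiscriminantInt) →
      ∃ s : ℚ, shaAn W = (s : ℂ) ∧ padicValRat p s ≤ 0) :
    Rest3NoWitnessBranchAtFive := by
  intro W _ _ p _ hram htors hno
  refine p2OpenInputOnTreeAt_of_imp_surj W p fun hX hp5 hsj ↦ ?_
  obtain ⟨s, hs, hv⟩ := hSha W p hX hp5 hsj hram htors hno
  exact openInputOnTreeAt_of_shaAn_nonpos_of_thm331Mult W p h331 hGZ hKo hSk hGZK hmod hram hs hv

/-- **The crux body (REST‴, item 19624) VERBATIM ⟸ the `Ш_an` datum on ALL REST‴ pairs** (Locus and REST⁗ alike; no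
Tamagawa case split, no Heegner field): published facts + JSW17 Thm. 3.3.1-mult + `hSha` at every X11b pair with `p ≥ 5`,
`ρ̄` onto, a (ram) witness and no erratum datum. CONDITIONAL; `hSha` is a per-pair data currency — attested with 0
exceptions on the 703 204 REST‴ pairs `N < 5·10⁵` (HOME/rest/SHA-CENSUS-REST3.md), FALSE class-wide exactly where `Ш(E)[p] ≠ 0`
granted BSD (§1); BSD is proved for no pair; nothing booked. [cite: Castella2018Erratum, Thm. 1.1 (iii)–(iv)]
[cite: JetchevSkinnerWan2017, Thm. 3.3.1, §7.4.1] [cite: Skinner2016PacificMC, Thm. C (§1)] [cite: Miller2011LMS, Def. 1.1] -/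
theorem ramNoErratumDataAtFive_body_of_shaAnNonpos_of_thm331Mult
    (h331 : JetchevSkinnerWan2017.thm331_anticyclotomicControl_mult)
    (hGZ : ∀ (N : ℕ) [NeZero N] (W : WeierstrassCurve ℚ) (K : Type) [Field K] [NumberField K],
      gross_zagier N W K)
    (hKo : ∀ (N : ℕ) [NeZero N] (W : WeierstrassCurve ℚ) (K : Type) [Field K] [NumberField K],
      kolyvagin N W K)
    (hSk : Skinner2016.thmC_padicValRat_bsd_rank_zero)
    (hGZK : rank_eq_analyticRank_of_analyticRank_le_one) (hmod : hasEntireLFunction_rat)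
    (hSha : ∀ (W : WeierstrassCurve ℚ) [W.IsElliptic] [W.IsGloballyMinimal] (p : ℕ) [Fact p.Prime],
      ClassX11b W p → 5 ≤ p → Rank1Residual.Surj W p → Rank1Residual.Ram W p →
      ¬ ((∃ (q : ℕ) (_ : Fact q.Prime), q ≠ 2 ∧ q ≠ p ∧ Rank1Residual.Mult W q ∧
          ¬ W.HasSplitMultiplicativeReductionAtPrime q ∧ ¬ p ∣ padicValInt q W.minimalDiscriminantInt) ∧
        (∀ P : (W.baseChange ℚ_[p]).toAffine.Point, p • P = 0 → P = 0)) →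
      ∃ s : ℚ, shaAn W = (s : ℂ) ∧ padicValRat p s ≤ 0) :
    ∀ (W : WeierstrassCurve ℚ) [W.IsElliptic] [W.IsGloballyMinimal] (p : ℕ) [Fact p.Prime],
      Literature.NumberTheory.EllipticCurves.Rank1Residual.Ram W p →
      ¬ ((∃ (q : ℕ) (_ : Fact q.Prime), q ≠ 2 ∧ q ≠ p ∧ Literature.NumberTheory.EllipticCurves.Rank1Residual.Mult W q ∧
          ¬ W.HasSplitMultiplicativeReductionAtPrime q ∧ ¬ p ∣ padicValInt q W.minimalDiscriminantInt) ∧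
        (∀ P : (W.baseChange ℚ_[p]).toAffine.Point, p • P = 0 → P = 0)) →
      Summit.BirchSwinnertonDyer.Rank1Residual.X11b.P2OpenInputOnTreeAt W p := by
  intro W _ _ p _ hram hno
  refine p2OpenInputOnTreeAt_of_imp_surj W p fun hX hp5 hsj ↦ ?_
  obtain ⟨s, hs, hv⟩ := hSha W p hX hp5 hsj hram hno
  exact openInputOnTreeAt_of_shaAn_nonpos_of_thm331Mult W p h331 hGZ hKo hSk hGZK hmod hram hs hv

end Summit.BirchSwinnertonDyer.BirchSwinnertonDyer.Theorems

end
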